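import Summits.KontsevichZagierPeriods.KontsevichZagierPeriods.Theorems.KzOnePeriodsE1Derivation

/-!
# KontsevichZagierPeriods — kz1p class E1 derivations, part 4: the second-kind rows (form `η = x dx/(2y)`)

Cell pub-kz1p (KZ 1-periods), seat b2b-kz1p-2 (IMPLEMENTER), gen 14; helper of the rung-1 item
`stmt-KontsevichZagierPeriods-4990`.  Parts 1–3 (`KzOnePeriodsE1DerivSpan`, `KzOnePeriodsE1DerivRealLogs`,
`KzOnePeriodsE1Derivation`) replay every point relation `Σ cᵢ Xᵢ = O` of a kz1p certificate as a CONNECTED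
derivation, inside the tree's formal period space `CurvePeriods` (Huber–Wüstholz 2022, §13.1, Thm. 13.3 (2)),
of the first-kind row `Σ cᵢ u(Xᵢ) = n₁ω₁ + n₂ω₂`.  kz1p attaches to every such relation a SECOND-KIND row
(`PTk-eta`): `Σ cᵢ ζ(u(Xᵢ)) + K + n₁H₁ + n₂H₂ = 0`, `H_j = −η_j = −2ζ(ω_j/2)`, with an exact constant `K ∈ ℚ`
(the sum of the chord / tangent constants `(y_R − y_X)/(x_R − x_X)` resp. `(3x_R² + a)/(2y_R)` of the addition
chain: the addition theorem `ζ(u+v) = ζ(u) + ζ(v) + ½(℘′(u) − ℘′(v))/(℘(u) − ℘(v))` and quasi-periodicity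
`ζ(z + ω) = ζ(z) + η(ω)`).  This file supplies what the case files need to replay these rows:

* SYMBOL LEVEL.  kz1p's form of the second kind is `η = x dx/(2y) = ½θ₁` (`θ₁ = x·θ₀` the tree's polynomial
  representative; (R1b) `span_sym_eta_sub`); its lifted symbol `(E_L, ½θ₁, φ∘D)`, `D : t₀ ↝ t₀ + m`, has period
  `−(ζ(t₀ + m) − ζ(t₀))` (`evalCombination_sym_eta`).  `span_zsum_theta1`: an integer relation `Σ nₗ mₗ = 0`
  among algebraic logarithms makes `Σ nₗ (E_L, θ₁, φ∘Dₗ) − c·(𝔸¹, dt, [0,1])` an element of `⟨(R1)–(R5)⟩_ℚ̄`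
  for SOME algebraic constant `c`, at EVERY algebraic base point `t₀` (`Ell.zexpand` / `Ell.zzero` at a generic
  base point; re-basing by `Ell.LiftData.span_translate_theta1`, whose algebraic constant `R(ψ_v(b)) − R(ψ_v(a))`
  is (R4)+(R5)).  `span_eta_row` pins the constant by EVALUATION (soundness, Thm. 13.3 (2)): given the numbers
  `z_l`, algebraic `e_l` with `ζ(t₀ + mₗ) − ζ(t₀) = zₗ + eₗ` and an identity `Σ nₗ zₗ + k = 0` with `k`
  algebraic, the combination `Σ nₗ ((E_L, ½θ₁, φ∘Dₗ) + eₗ·𝟙) − k·𝟙` lies in `⟨(R1)–(R5)⟩_ℚ̄`; `eta_row_of_span`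
  is the converse direction (soundness) used to state the relation between the actual integrals.
* NUMBER LEVEL (the moves of the chain, exact constants): `zeta_chord`, `zeta_tangent` (addition / duplication
  theorem for `ζ` with the constant certified by a polynomial identity in the rational coordinates),
  `zeta_closing` (`u + v ∈ Λ`), `zeta_add_of_mem` / `zeta_add_minRealPeriod` / `zeta_add_two_mul` /
  `zeta_add_int_mul` / `zeta_add_int_comb` (quasi-periodicity `ζ(z + ℓ) = ζ(z) + 2ζ(ℓ/2)`, `ℓ ∈ Λ`), and the
  base-point dictionary `zeta_base_point`: `ζ(t₀ + u) − ζ(t₀) = ζ(u) + (℘′(t₀)/2 − y)/(℘(t₀) − x)` for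
  `φ(u) = (x, y)` — the algebraic constant `eₗ` by which the re-based symbol differs from kz1p's `ζ(u(X))`
  (`isAlgebraic_baseSlope`); `exists_base_lifts₂` gives base points generic for it (`℘(t₀) ≠ x`).

Dictionary (kz1p ↔ tree): `ZT:X = ζ(u_X)` ↔ `−(E_L, ½θ₁, φ∘D_X) − e_X·𝟙` (value `ζ(u_X)`), `H_j` ↔
`−(E_L, ½θ₁, φ∘D_{ω_j})` (value `−η_j`; `e = 0` for a closed loop), `ONE` ↔ `(𝔸¹, dt, [0,1])`.
No named facts, no `sorry`, no new definitions.

References: [HuberWustholz2022] A. Huber, G. Wüstholz, *Transcendence and linear relations of 1-periods*,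
Cambridge Tracts 227 (2022), §13.1 (A)–(B) (p. 120), Thm. 13.3 (2) (p. 121), §18.1 (pp. 160–161);
[ArmitageEberlein2001] §7.4.2 (7.66); [WhittakerWatson1927] §20.41; [KontsevichZagier2001] §1.2.
-/

noncomputable section

open MvPolynomial Set Complex
open Literature.NumberTheory.Transcendental Literature.NumberTheory.Transcendental.CurvePeriods
open Literature.NumberTheory.Transcendental.CurvePeriods.Ell
open scoped PeriodPair

namespace Summit.KontsevichZagierPeriods.KzOnePeriods.E1LiftDerivation

open E1RealLogs

/-- `c ∈ ⟨(R1)–(R5)⟩_ℚ̄`: `c` is a `ℚ̄`-linear combination of elementary relations. -/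
local notation3 "InSpanRel " c:arg => ∃ (k : ℕ) (ρ : Fin k → (PeriodSymbol →₀ ℂ))
  (a : Fin k → ℂ), (∀ i, IsElementaryRelation (ρ i)) ∧ (∀ i, IsAlgebraic ℚ (a i)) ∧
    c = ∑ i, a i • ρ i

variable {L : PeriodPair} (h₂ : IsAlgebraic ℚ L.g₂) (h₃ : IsAlgebraic ℚ L.g₃)

/-- The `θ₁`-symbol `(E_L, θ₁, φ∘D)` of a lift `D` (`θ₁ = x dx/y`). -/
local notation3 "S₁[" D "]" => LiftData.sym h₂ h₃ D (theta1 L) (hasAlgCoeffs_theta1 L h₂ h₃)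

/-- The unit symbol `(𝔸¹, dt, [0,1])` (period `1`). -/
local notation3 "𝟙" => (Finsupp.single PeriodSymbol.unit (1 : ℂ) : PeriodSymbol →₀ ℂ)

/-! ### Symbol level: the form `η = x dx/(2y) = ½θ₁` -/

include h₂ h₃ in
/-- `½θ₁` has algebraic coefficients. [folklore] -/
theorem hasAlgCoeffs_half_theta1 : ∀ k, HasAlgCoeffs (((1 / 2 : ℂ) • theta1 L) k) := fun k => by
  have h : IsAlgebraic ℚ (1 / 2 : ℂ) := by rw [one_div]; exact (isAlgebraic_nat 2).inv
  have e : ((1 / 2 : ℂ) • theta1 L) k = C (1 / 2 : ℂ) * theta1 L k := by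
    rw [Pi.smul_apply, smul_eq_C_mul]
  rw [e]
  exact (hasAlgCoeffs_C h).mul (hasAlgCoeffs_theta1 L h₂ h₃ k)

/-- The kz1p symbol `(E_L, ½θ₁, φ∘D)` of a lift `D` (form `η = x dx/(2y)`). -/
local notation3 (prettyPrint := false) "Sη[" D "]" =>
  LiftData.sym h₂ h₃ D ((1 / 2 : ℂ) • theta1 L) (hasAlgCoeffs_half_theta1 h₂ h₃)

include h₂ h₃ in
/-- **(R1b)**: `(E_L, ½θ₁, γ) − ½ (E_L, θ₁, γ) ∈ ⟨(R1)–(R5)⟩_ℚ̄`. [cite: HuberWustholz2022, §13.1 (A) (p. 120)] -/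
theorem span_sym_eta_sub {a b : ℂ} (D : LiftData L a b) :
    InSpanRel (Sη[D] - (1 / 2 : ℂ) • S₁[D]) := by
  have h : IsAlgebraic ℚ (1 / 2 : ℂ) := by rw [one_div]; exact (isAlgebraic_nat 2).inv
  refine ⟨1, fun _ => Sη[D] - (1 / 2 : ℂ) • S₁[D], fun _ => 1, fun _ => ?_,
    fun _ => isAlgebraic_one, by simp⟩
  exact IsElementaryRelation.smul (curve L) (smooth L h₂ h₃) D.path (1 / 2 : ℂ) h (theta1 L)
    ((1 / 2 : ℂ) • theta1 L) (hasAlgCoeffs_theta1 L h₂ h₃) (hasAlgCoeffs_half_theta1 h₂ h₃) rfl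

include h₂ h₃ in
/-- **The period of the kz1p symbol of the second kind**: `∫_{φ∘D} x dx/(2y) = −(ζ(b) − ζ(a))` for a lift
`D : a ↝ b` (`x dx/y = 2℘(z) dz = −2 dζ`). [cite: HuberWustholz2022, §18.1 (p. 160)] -/
theorem evalCombination_sym_eta {a b : ℂ} (D : LiftData L a b) :
    evalCombination Sη[D] = -(L.weierstrassZeta b - L.weierstrassZeta a) := by
  have h0 := G0Derivation.evalCombination_eq_zero_of_span (span_sym_eta_sub h₂ h₃ D)
  rw [evalCombination_sub, evalCombination_smul, LiftData.evalCombination_sym_theta1, sub_eq_zero] at h0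
  rw [h0]; ring

/-- The period of the single symbol underlying `Sη[D]` is `−(ζ(b) − ζ(a))`.
[cite: HuberWustholz2022, §18.1 (p. 160)] -/
theorem period_sym_eta {a b : ℂ} (D : LiftData L a b) :
    PeriodSymbol.period ⟨curve L, smooth L h₂ h₃, (1 / 2 : ℂ) • theta1 L,
      hasAlgCoeffs_half_theta1 h₂ h₃, D.path⟩ = -(L.weierstrassZeta b - L.weierstrassZeta a) := by
  have h := evalCombination_sym_eta h₂ h₃ D
  rwa [LiftData.sym, evalCombination_single, one_mul] at h

/-- A finite `ℤ`-combination of algebraic numbers is algebraic. [folklore] -/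
theorem isAlgebraic_zsum {r : ℕ} (n : Fin r → ℤ) (κ : Fin r → ℂ) (h : ∀ l, IsAlgebraic ℚ (κ l)) :
    IsAlgebraic ℚ (∑ l, (n l : ℂ) * κ l) :=
  Finset.sum_induction _ (fun x => IsAlgebraic ℚ x) (fun _ _ ha hb => ha.add hb) isAlgebraic_zero
    fun l _ => (isAlgebraic_int (n l)).mul (h l)

include h₂ h₃ in
/-- **Symbol-level ℤ-linear relation of `θ₁`-symbols at every base point, up to an algebraic constant.**
Let `m_l` be algebraic logarithms and `n_l ∈ ℤ` with `Σ_l n_l m_l = 0`.  Then for EVERY algebraic base point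
`t₀` and ALL lifts `D_l : t₀ ↝ t₀ + m_l` there is an algebraic `c` with
`Σ_l n_l (E_L, θ₁, φ∘D_l) − c·(𝔸¹, dt, [0,1]) ∈ ⟨(R1)–(R5)⟩_ℚ̄`.  Proof: at a base point `t₁` generic for
`Ell.zexpand` and for `t₁ ∉ t₀ + Λ`, `2t₁ ∉ t₀ + Λ`, `2t₁ ∉ t₀ − m_l + Λ` this holds (`zexpand`, second part,
+ `zzero`); translation by the algebraic point `φ(t₀ − t₁)` carries `(E_L, θ₁, φ∘D′_l)`, `D′_l : t₁ ↝ t₁ + m_l`,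
to `(E_L, θ₁, φ∘D_l)` up to the algebraic constant `R(ψ_v(t₁ + m_l)) − R(ψ_v(t₁))` times the unit symbol
(`span_translate_theta1`, (R4)+(R5)). [cite: HuberWustholz2022, §13.1 (B) (p. 120), §18.1 (pp. 160–161)] -/
theorem span_zsum_theta1 {r : ℕ} (m : Fin r → ℂ) (hm : ∀ l, AlgLog L (m l)) (n : Fin r → ℤ)
    (hsum : ∑ l, (n l : ℂ) * m l = 0) {t₀ : ℂ} (ht₀ : IsAlgPt L t₀)
    (D : ∀ l, LiftData L t₀ (t₀ + m l)) :
    ∃ c : ℂ, IsAlgebraic ℚ c ∧ InSpanRel (∑ l, (n l : ℂ) • S₁[D l] - c • 𝟙) := by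
  classical
  have ht : ∀ l, t₀ + m l ∉ L.lattice := fun l => (D l).alg_stop.1
  obtain ⟨B, hB⟩ := zexpand h₂ h₃ r m hm n
  obtain ⟨t₁, ht₁, hgen, hgen2⟩ := exists_generic_algPt₂ h₂ h₃ (insert t₀ B)
    (insert t₀ (Finset.univ.image fun l => t₀ - m l))
  obtain ⟨halg, halgs, hrel⟩ := hB t₁ ht₁ (fun b hb => hgen b (Finset.mem_insert_of_mem hb))
  set v := t₀ - t₁ with hv
  have hv0 : v ∉ L.lattice := by
    intro h
    exact hgen t₀ (Finset.mem_insert_self t₀ B) (by simpa [hv] using neg_mem h)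
  have hvalg : IsAlgPt L v := (ht₀.algLog.sub L h₂ ht₁.algLog).isAlgPt hv0
  have D₁ : ∀ l, LiftData L t₁ (t₁ + m l) := fun l => (LiftData.nonempty ht₁ (halg l)).some
  obtain ⟨Dsum⟩ := LiftData.nonempty ht₁ halgs
  have hz : t₁ + ∑ l, (n l : ℂ) * m l = t₁ := by rw [hsum, add_zero]
  obtain ⟨c₁, hc₁, h1⟩ := (hrel Dsum D₁).2
  have h2 : InSpanRel (S₁[Dsum]) := zzero h₂ h₃ hz Dsum _ _
  have h3 : InSpanRel (∑ l, (n l : ℂ) • S₁[D₁ l] + c₁ • 𝟙) := by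
    have h := CurvePeriods.span_sub h2 h1
    have e : S₁[Dsum] - (S₁[Dsum] - ∑ l, (n l : ℂ) • S₁[D₁ l] - c₁ • 𝟙) =
        ∑ l, (n l : ℂ) • S₁[D₁ l] + c₁ • 𝟙 := by abel
    rwa [e] at h
  have h4 : ∀ l, ∃ κ : ℂ, IsAlgebraic ℚ κ ∧ InSpanRel (S₁[D l] - S₁[D₁ l] - κ • 𝟙) := by
    intro l
    have e0 : t₁ + v = t₀ := by rw [hv]; ring
    have e1 : t₁ + m l + v = t₀ + m l := by rw [hv]; ring
    have ha : ℘[L] t₁ ≠ ℘[L] v := by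
      rw [weierstrassP_ne_iff L ht₁.1 hv0]
      refine ⟨by rw [e0]; exact ht₀.1, ?_⟩
      have : 2 * t₁ - t₀ ∉ L.lattice := hgen2 t₀ (Finset.mem_insert_self _ _)
      convert this using 1; rw [hv]; ring
    have hb : ℘[L] (t₁ + m l) ≠ ℘[L] v := by
      rw [weierstrassP_ne_iff L (halg l).1 hv0]
      refine ⟨by rw [e1]; exact ht l, ?_⟩
      have : 2 * t₁ - (t₀ - m l) ∉ L.lattice := hgen2 (t₀ - m l)
        (Finset.mem_insert_of_mem (Finset.mem_image_of_mem _ (Finset.mem_univ l)))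
      convert this using 1; rw [hv]; ring
    have key := LiftData.span_translate_theta1 h₂ h₃ hvalg (D₁ l) ((D l).cast e0.symm e1.symm) ha hb
    rw [LiftData.sym_cast] at key
    exact ⟨_, isAlgebraic_translate_const L hvalg ht₁ (halg l), key⟩
  choose κ hκ hκs using h4
  have h5 : InSpanRel (∑ l, (n l : ℂ) • (S₁[D l] - S₁[D₁ l] - κ l • 𝟙)) :=
    CurvePeriods.span_finsetSum _ _ fun l _ => CurvePeriods.span_smul (isAlgebraic_int (n l)) (hκs l)
  refine ⟨∑ l, (n l : ℂ) * κ l - c₁, (isAlgebraic_zsum n κ hκ).sub hc₁, ?_⟩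
  have e : ∑ l, (n l : ℂ) • S₁[D l] - (∑ l, (n l : ℂ) * κ l - c₁) • 𝟙 =
      ∑ l, (n l : ℂ) • (S₁[D l] - S₁[D₁ l] - κ l • 𝟙) + (∑ l, (n l : ℂ) • S₁[D₁ l] + c₁ • 𝟙) := by
    simp only [smul_sub, smul_smul, Finset.sum_sub_distrib, sub_smul, Finset.sum_smul]
    abel
  rw [e]
  exact CurvePeriods.span_add h5 h3

include h₂ h₃ in
/-- **The second-kind row at every base point (symbol level).**  Let `m_l` be algebraic logarithms, `n_l ∈ ℤ`
with `Σ n_l m_l = 0`, `t₀` an algebraic base point and `D_l : t₀ ↝ t₀ + m_l` lifts.  Suppose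
`ζ(t₀ + m_l) − ζ(t₀) = z_l + e_l` and `Σ n_l z_l + k = 0`.  Then
`Σ_l n_l ((E_L, ½θ₁, φ∘D_l) + e_l·𝟙) − k·𝟙 ∈ ⟨(R1)–(R5)⟩_ℚ̄`: the unknown algebraic constant `c` of
`span_zsum_theta1` is determined by evaluating (soundness, Thm. 13.3 (2), `∫_{φ∘D_l} ½θ₁ = −(z_l + e_l)`):
`c/2 = k − Σ n_l e_l` (so this number is algebraic; in the case files `e_l` and `k` are visibly algebraic:
`e_l` = the base-point constant `(℘′(t₀)/2 − y_l)/(℘(t₀) − x_l)` of `zeta_base_point`, or `0` for a closed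
loop, and `k ∈ ℚ` = kz1p's `ONE`-coefficient).
[cite: HuberWustholz2022, §13.1 (A)–(B) (p. 120), Thm. 13.3 (2) (p. 121), §18.1 (pp. 160–161)] -/
theorem span_eta_row {r : ℕ} (m : Fin r → ℂ) (hm : ∀ l, AlgLog L (m l)) (n : Fin r → ℤ)
    (hsum : ∑ l, (n l : ℂ) * m l = 0) {t₀ : ℂ} (ht₀ : IsAlgPt L t₀)
    (D : ∀ l, LiftData L t₀ (t₀ + m l)) (e z : Fin r → ℂ)
    (hz : ∀ l, L.weierstrassZeta (t₀ + m l) - L.weierstrassZeta t₀ = z l + e l)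
    (k : ℂ) (hrow : ∑ l, (n l : ℂ) * z l + k = 0) :
    InSpanRel (∑ l, (n l : ℂ) • (Sη[D l] + e l • 𝟙) - k • 𝟙) := by
  have hhalf : IsAlgebraic ℚ (1 / 2 : ℂ) := by rw [one_div]; exact (isAlgebraic_nat 2).inv
  obtain ⟨c, -, h1⟩ := span_zsum_theta1 h₂ h₃ m hm n hsum ht₀ D
  have h2 : InSpanRel (∑ l, (n l : ℂ) • (Sη[D l] - (1 / 2 : ℂ) • S₁[D l])) :=
    CurvePeriods.span_finsetSum _ _ fun l _ => CurvePeriods.span_smul (isAlgebraic_int (n l))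
      (span_sym_eta_sub h₂ h₃ (D l))
  have h3 : InSpanRel (∑ l, (n l : ℂ) • Sη[D l] - (c / 2) • 𝟙) := by
    have h := CurvePeriods.span_add h2 (CurvePeriods.span_smul hhalf h1)
    have e1 : ∑ l, (n l : ℂ) • (Sη[D l] - (1 / 2 : ℂ) • S₁[D l]) +
        (1 / 2 : ℂ) • (∑ l, (n l : ℂ) • S₁[D l] - c • 𝟙) =
        ∑ l, (n l : ℂ) • Sη[D l] - (c / 2) • 𝟙 := by
      have ec : ∀ l, (n l : ℂ) • ((1 / 2 : ℂ) • S₁[D l]) = (1 / 2 : ℂ) • ((n l : ℂ) • S₁[D l]) :=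
        fun l => smul_comm _ _ _
      simp only [smul_sub, Finset.sum_sub_distrib, Finset.smul_sum, ec, smul_smul,
        show (1 / 2 : ℂ) * c = c / 2 by ring]
      abel
    rwa [e1] at h
  have hX0 := G0Derivation.evalCombination_eq_zero_of_span h3
  have hev : evalCombination (∑ l, (n l : ℂ) • Sη[D l] - (c / 2) • 𝟙) =
      -(∑ l, (n l : ℂ) * z l + k) + (k - ∑ l, (n l : ℂ) * e l) - c / 2 := by
    rw [evalCombination_sub, evalCombination_smul, evalCombination_single, period_unit,
      evalCombination_finsetSum]
    simp only [evalCombination_smul, evalCombination_sym_eta h₂ h₃, hz, mul_neg, mul_add,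
      Finset.sum_neg_distrib, Finset.sum_add_distrib]
    ring
  rw [hev, hrow] at hX0
  have hc2 : c / 2 = k - ∑ l, (n l : ℂ) * e l := by linear_combination -hX0
  have e2 : ∑ l, (n l : ℂ) • (Sη[D l] + e l • 𝟙) - k • 𝟙 = ∑ l, (n l : ℂ) • Sη[D l] - (c / 2) • 𝟙 := by
    rw [hc2]
    simp only [smul_add, Finset.sum_add_distrib, smul_smul, sub_smul, Finset.sum_smul]
    abel
  rw [e2]
  exact h3

/-- **Soundness for the second-kind row**: if `Σ_l n_l ((E_L, ½θ₁, φ∘D_l) + e_l·𝟙) − k·𝟙 ∈ ⟨(R1)–(R5)⟩_ℚ̄`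
then `Σ_l n_l (∫_{φ∘D_l} x dx/(2y) + e_l) − k = 0`. [cite: HuberWustholz2022, Thm. 13.3 (2) (p. 121)] -/
theorem eta_row_of_span {r : ℕ} {t₀ : ℂ} {m : Fin r → ℂ} (D : ∀ l, LiftData L t₀ (t₀ + m l))
    (n : Fin r → ℂ) (e : Fin r → ℂ) (k : ℂ)
    (h : InSpanRel (∑ l, n l • (Sη[D l] + e l • 𝟙) - k • 𝟙)) :
    ∑ l, n l * (PeriodSymbol.period ⟨curve L, smooth L h₂ h₃, (1 / 2 : ℂ) • theta1 L,
      hasAlgCoeffs_half_theta1 h₂ h₃, (D l).path⟩ + e l) - k = 0 := by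
  have h0 := G0Derivation.evalCombination_eq_zero_of_span h
  rw [evalCombination_sub, evalCombination_smul, evalCombination_single, period_unit,
    evalCombination_finsetSum] at h0
  simp only [evalCombination_smul, evalCombination_add, evalCombination_single, period_unit,
    LiftData.sym] at h0
  rw [← h0]
  congr 1
  · refine Finset.sum_congr rfl fun l _ => ?_
    ring
  · ring

/-! ### Base points -/

include h₂ h₃ in
/-- **Base points generic for the second-kind dictionary**: for algebraic logarithms `m₁, …, m_r` there is an
algebraic base point `t₀` with `t₀ ± m_l ∉ Λ`, hence lifts `D_l : t₀ ↝ t₀ + m_l` AND `℘(t₀) ≠ ℘(m_l)` whenever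
`m_l ∉ Λ` (`exists_generic_algPt`, `weierstrassP_ne_iff`). [cite: HuberWustholz2022, §18.1 (p. 160)] -/
theorem exists_base_lifts₂ {r : ℕ} (m : Fin r → ℂ) (hm : ∀ l, AlgLog L (m l)) :
    ∃ t₀ : ℂ, IsAlgPt L t₀ ∧ (∀ l, Nonempty (LiftData L t₀ (t₀ + m l))) ∧
      ∀ l, m l ∉ L.lattice → ℘[L] t₀ ≠ ℘[L] (m l) := by
  classical
  obtain ⟨t₀, ht₀, hB⟩ := exists_generic_algPt L h₂ h₃
    ((Finset.univ.image fun l => -m l) ∪ Finset.univ.image fun l => m l)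
  have hp : ∀ l, t₀ + m l ∉ L.lattice := fun l => by
    simpa [sub_neg_eq_add] using hB (-m l)
      (Finset.mem_union_left _ (Finset.mem_image_of_mem _ (Finset.mem_univ l)))
  refine ⟨t₀, ht₀, fun l => ?_, fun l hl => ?_⟩
  · exact LiftData.nonempty ht₀ ((ht₀.algLog.add L h₂ (hm l)).isAlgPt (hp l))
  · rw [weierstrassP_ne_iff L ht₀.1 hl]
    exact ⟨hp l, hB (m l) (Finset.mem_union_right _ (Finset.mem_image_of_mem _ (Finset.mem_univ l)))⟩

/-- **The base-point constant is algebraic**: `(℘′(t₀)/2 − y)/(℘(t₀) − x)` for an algebraic base point and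
algebraic `x, y`. [folklore] -/
theorem isAlgebraic_baseSlope {t₀ x y : ℂ} (ht₀ : IsAlgPt L t₀) (hx : IsAlgebraic ℚ x)
    (hy : IsAlgebraic ℚ y) : IsAlgebraic ℚ ((℘'[L] t₀ / 2 - y) / (℘[L] t₀ - x)) := by
  have h0 : IsAlgebraic ℚ (℘[L] t₀) := by simpa [phi] using ht₀.2 0
  have h1 : IsAlgebraic ℚ (℘'[L] t₀ / 2) := by simpa [phi] using ht₀.2 1
  rw [div_eq_mul_inv]
  exact (h1.sub hy).mul (h0.sub hx).inv

/-! ### Number level: the Weierstrass `ζ`-function along the chain -/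

/-- **Quasi-periodicity under a general period**: `ζ(z + ℓ) = ζ(z) + 2ζ(ℓ/2)` for `ℓ ∈ Λ` and every `z`
(`η(mω₁ + nω₂) = mη₁ + nη₂`, evaluated at `z = −ℓ/2` with `ζ` odd). [cite: WhittakerWatson1927, §20.41] -/
theorem zeta_add_of_mem {ℓ : ℂ} (hℓ : ℓ ∈ L.lattice) (z : ℂ) :
    L.weierstrassZeta (z + ℓ) = L.weierstrassZeta z + 2 * L.weierstrassZeta (ℓ / 2) := by
  obtain ⟨m, n, rfl⟩ := PeriodPair.mem_lattice.1 hℓ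
  have h1 := L.weierstrassZeta_add_period m n (-((m * L.ω₁ + n * L.ω₂) / 2))
  rw [L.weierstrassZeta_neg, show -((↑m * L.ω₁ + ↑n * L.ω₂) / 2) + (↑m * L.ω₁ + ↑n * L.ω₂) =
    (↑m * L.ω₁ + ↑n * L.ω₂) / 2 by ring] at h1
  rw [L.weierstrassZeta_add_period m n z]
  linear_combination -h1

/-- `ζ(z + Ω₁) = ζ(z) + 2ζ(Ω₁/2)` (`= ζ(z) − H₁` in kz1p's notation), `Ω₁` the least positive real period.
[cite: WhittakerWatson1927, §20.41] -/
theorem zeta_add_minRealPeriod (hL : L.IsReal) : ∀ z, L.weierstrassZeta (z + ((L.minRealPeriod : ℝ) : ℂ)) =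
    L.weierstrassZeta z + 2 * L.weierstrassZeta ((L.minRealPeriod / 2 : ℝ) : ℂ) := fun z => by
  rw [zeta_add_of_mem (minRealPeriod_mem hL), Complex.ofReal_div, Complex.ofReal_ofNat]

/-- `ζ(z + 2w) = ζ(z) + 2ζ(w)` for a half-period `w` (`2w ∈ Λ`), e.g. `w = w_I`, `2w_I = ω₂`.
[cite: WhittakerWatson1927, §20.41] -/
theorem zeta_add_two_mul {w : ℂ} (h2w : 2 * w ∈ L.lattice) : ∀ z, L.weierstrassZeta (z + 2 * w) =
    L.weierstrassZeta z + 2 * L.weierstrassZeta w := fun z => by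
  rw [zeta_add_of_mem h2w, mul_div_cancel_left₀ w two_ne_zero]

/-- `ζ(z + jℓ) = ζ(z) + jE` for `j ∈ ℤ` if `ζ(z + ℓ) = ζ(z) + E` for all `z`. [cite: WhittakerWatson1927, §20.41] -/
theorem zeta_add_int_mul {ℓ E : ℂ} (h : ∀ z, L.weierstrassZeta (z + ℓ) = L.weierstrassZeta z + E) (j : ℤ) :
    ∀ z, L.weierstrassZeta (z + (j : ℂ) * ℓ) = L.weierstrassZeta z + (j : ℂ) * E := by
  induction j using Int.induction_on with
  | zero => intro z; simp
  | succ n ih =>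
    intro z
    have h1 := ih z
    have h2 := h (z + ((n : ℤ) : ℂ) * ℓ)
    have e : z + (((n : ℤ) + 1 : ℤ) : ℂ) * ℓ = z + ((n : ℤ) : ℂ) * ℓ + ℓ := by push_cast; ring
    rw [e, h2, h1]; push_cast; ring
  | pred n ih =>
    intro z
    have h1 := ih z
    have h2 := h (z + ((-(n : ℤ) - 1 : ℤ) : ℂ) * ℓ)
    have e : z + ((-(n : ℤ) - 1 : ℤ) : ℂ) * ℓ + ℓ = z + ((-(n : ℤ) : ℤ) : ℂ) * ℓ := by push_cast; ring
    rw [e, h1] at h2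
    push_cast at h2 ⊢
    linear_combination -h2

/-- `ζ(z + jℓ₁ + kℓ₂) = ζ(z) + jE₁ + kE₂`. [cite: WhittakerWatson1927, §20.41] -/
theorem zeta_add_int_comb {ℓ₁ E₁ ℓ₂ E₂ : ℂ}
    (h₁ : ∀ z, L.weierstrassZeta (z + ℓ₁) = L.weierstrassZeta z + E₁)
    (h₂ : ∀ z, L.weierstrassZeta (z + ℓ₂) = L.weierstrassZeta z + E₂) (j k : ℤ) :
    ∀ z, L.weierstrassZeta (z + ((j : ℂ) * ℓ₁ + (k : ℂ) * ℓ₂)) =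
      L.weierstrassZeta z + ((j : ℂ) * E₁ + (k : ℂ) * E₂) := fun z => by
  rw [← add_assoc, zeta_add_int_mul h₂ k, zeta_add_int_mul h₁ j]; ring

/-- A closed loop: `ζ(t₀ + ℓ) − ζ(t₀) = E + 0`. [cite: WhittakerWatson1927, §20.41] -/
theorem zeta_base_period {ℓ E : ℂ} (h : ∀ z, L.weierstrassZeta (z + ℓ) = L.weierstrassZeta z + E)
    (t₀ : ℂ) : L.weierstrassZeta (t₀ + ℓ) - L.weierstrassZeta t₀ = E + 0 := by
  rw [h t₀]; ring

/-- **The base-point dictionary**: `ζ(t₀ + u) − ζ(t₀) = ζ(u) + (℘′(t₀)/2 − y)/(℘(t₀) − x)` for `φ(u) = (x, y)`,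
`t₀, u ∉ Λ`, `℘(t₀) ≠ x` (addition theorem for `ζ`). [cite: ArmitageEberlein2001, §7.4.2 (7.66)] -/
theorem zeta_base_point {t₀ u x y : ℂ} (ht : t₀ ∉ L.lattice) (hu : u ∉ L.lattice) (hX : phi L u = ![x, y])
    (hne : ℘[L] t₀ ≠ x) : L.weierstrassZeta (t₀ + u) - L.weierstrassZeta t₀ =
      L.weierstrassZeta u + (℘'[L] t₀ / 2 - y) / (℘[L] t₀ - x) := by
  obtain ⟨ex, ey⟩ := wp_eq_of_phi hX
  have hne' : ℘[L] t₀ ≠ ℘[L] u := by rw [ex]; exact hne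
  have h := L.weierstrassZeta_add_holds t₀ u ht hu hne'
  rw [ex, ey] at h
  rw [h]; ring

/-- **Chord step of the `ζ`-chain**: for `R = φ(u) = (x₁, y₁)`, `X = φ(v) = (x₂, y₂)`, `x₁ ≠ x₂`, and
`R + X = φ(w)` with `u + v − w = ℓ ∈ Λ`, `ζ(z + ℓ) = ζ(z) + E`:
`ζ(w) = ζ(u) + ζ(v) + λ − E`, `λ = (y₁ − y₂)/(x₁ − x₂)` (addition theorem + quasi-periodicity), in normal
form `c = a + b + λ − E` for any names `a, b, c` of `ζ(u), ζ(v), ζ(w)`.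
[cite: ArmitageEberlein2001, §7.4.2 (7.66)] [cite: WhittakerWatson1927, §20.41] -/
theorem zeta_chord {u v w ℓ E a b c x₁ y₁ x₂ y₂ lam : ℂ}
    (hE : ∀ z, L.weierstrassZeta (z + ℓ) = L.weierstrassZeta z + E)
    (hu : u ∉ L.lattice) (hv : v ∉ L.lattice) (h1 : phi L u = ![x₁, y₁]) (h2 : phi L v = ![x₂, y₂])
    (hx : x₁ ≠ x₂) (hw : u + v - w = ℓ) (hlam : lam * (x₁ - x₂) = y₁ - y₂)
    (ha : L.weierstrassZeta u = a) (hb : L.weierstrassZeta v = b) (hc : L.weierstrassZeta w = c) :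
    c = a + b + lam - E := by
  obtain ⟨ex1, ey1⟩ := wp_eq_of_phi h1
  obtain ⟨ex2, ey2⟩ := wp_eq_of_phi h2
  have hne : ℘[L] u ≠ ℘[L] v := by rw [ex1, ex2]; exact hx
  have hadd := L.weierstrassZeta_add_holds u v hu hv hne
  have e : u + v = w + ℓ := by linear_combination hw
  have hx' : x₁ - x₂ ≠ 0 := sub_ne_zero.2 hx
  have hl : (2 * y₁ - 2 * y₂) / (x₁ - x₂) / 2 = lam := by
    rw [div_div, div_eq_iff (mul_ne_zero hx' two_ne_zero)]; linear_combination -2 * hlam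
  rw [ex1, ex2, ey1, ey2, e, hE w, ha, hb, hc, hl] at hadd
  linear_combination hadd

/-- **Tangent step of the `ζ`-chain**: for `R = φ(u) = (x₁, y₁)`, `y₁ ≠ 0`, and `2R = φ(w)` with
`2u − w = ℓ ∈ Λ`: `ζ(w) = 2ζ(u) + λ − E`, `λ = (3x₁² + a)/(2y₁)` (duplication formula
`ζ(2u) = 2ζ(u) + ½℘″(u)/℘′(u)`, `℘″ = 6℘² − g₂/2`, `a = −g₂/4`).
[cite: ArmitageEberlein2001, §7.4.2 (7.66), Cor. 7.1] [cite: WhittakerWatson1927, §20.41] -/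
theorem zeta_tangent {u w ℓ E a c x₁ y₁ lam : ℂ}
    (hE : ∀ z, L.weierstrassZeta (z + ℓ) = L.weierstrassZeta z + E)
    (hu : u ∉ L.lattice) (h1 : phi L u = ![x₁, y₁]) (hy : y₁ ≠ 0) (hw : 2 * u - w = ℓ)
    (hlam : lam * (2 * y₁) = 3 * x₁ ^ 2 + A L)
    (ha : L.weierstrassZeta u = a) (hc : L.weierstrassZeta w = c) :
    c = 2 * a + lam - E := by
  obtain ⟨ex1, ey1⟩ := wp_eq_of_phi h1
  have hy' : (2 : ℂ) * y₁ ≠ 0 := mul_ne_zero two_ne_zero hy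
  have h' : ℘'[L] u ≠ 0 := by rw [ey1]; exact hy'
  have hdup := L.weierstrassZeta_two_mul hu h'
  rw [(L.hasDerivAt_derivWeierstrassP hu).deriv, ex1, ey1] at hdup
  have e : 2 * u = w + ℓ := by linear_combination hw
  have hlam' := hlam
  rw [A] at hlam'
  have hl : (6 * x₁ ^ 2 - L.g₂ / 2) / (2 * y₁) / 2 = lam := by
    rw [div_div, div_eq_iff (mul_ne_zero hy' two_ne_zero)]
    linear_combination -2 * hlam'
  rw [e, hE w, ha, hc, hl] at hdup
  linear_combination hdup

/-- **Closing step of the `ζ`-chain**: `u + v = ℓ ∈ Λ` gives `ζ(u) + ζ(v) = E` (`ζ` odd + quasi-periodicity).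
[cite: WhittakerWatson1927, §20.41] -/
theorem zeta_closing {u v ℓ E a b : ℂ} (hE : ∀ z, L.weierstrassZeta (z + ℓ) = L.weierstrassZeta z + E)
    (huv : u + v = ℓ) (ha : L.weierstrassZeta u = a) (hb : L.weierstrassZeta v = b) : a + b = E := by
  have e : v = -u + ℓ := by linear_combination huv
  rw [← ha, ← hb, e, hE, L.weierstrassZeta_neg]; ring

end Summit.KontsevichZagierPeriods.KzOnePeriods.E1LiftDerivation

end
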